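import Mathlib
import Summits.ResolutionOfSingularities.ResolutionOfSingularities.Theorems.RadicialJungCleanModelsCleanLU3Abhyankar
import Summits.ResolutionOfSingularities.ResolutionOfSingularities.Theorems.RadicialJungCleanModelsMonomializationGen
import HarnessLib

/-!
# Route `RadicialJung`, crux `CleanModels` (stmt-15917), line `Sketch` rev 35, stub 7 `stub_cleanModelsDimGEFour`: **clean local
# uniformization at `d`-dimensional centres for DEFECTLESS and for ABHYANKAR valuations, in EVERY dimension `d = n + 1`**, modulo embedded
# resolution of closed subsets of dimension `≤ N` (`n ≤ N`) of regular excellent schemes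

Explicit-unit seat `decomp-res-hand-2` g2 (structural hand, stubs 5–7).  OURS; nothing here proves resolution in characteristic `p`.
`…CleanLUDimCases.lean` (hand-2 g0) reduces the frontier stub `stub_cleanModelsDimGEFour` BY NAME to four inputs asked in every dimension
`d ≥ 4`: (7a) `hBest_d` — clean LU at a zero-dimensional valuation with a `d`-dimensional regular centre when `g₀` HAS a best `p`-th-power
approximation; (7b) `hAbh_d` — the same at Abhyankar valuations (transcendence defect `0`); (7c) the non-discrete defect residue; (7d) two-model
patching for `P_clean`.  THIS FILE discharges (7a) and (7b) for every `d = n + 1` MODULO ONE classical hypothesis: `hEmb` = embedded resolution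
of closed proper subsets of dimension `≤ N`, `n ≤ N`, of regular excellent integral Noetherian schemes, in the shape of Cossart–Jannsen–Saito
2020 Cor. 1.5 (PRINTED for `N ≤ 2` only; for `N ≥ 3` it is the open embedded-resolution problem and is carried as a hypothesis, never asserted):

* `cleanLU_dim_of_isMin_pthPowerApprox` — the tree's ✓ `cleanLU3_of_isMin_pthPowerApprox` (`…CleanLU3Defectless.lean`, `dim = 3`, CJS
  Cor. 1.5) with `3 ↦ n + 1` and `hEmb ↦ hEmb_N`: write `g₀ − f₀^p = x / y`, monomialize `x · y · s` along `v` by the dimension-free bottleneck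
  ✓ `exists_localRing_monomial_of_embeddedResolution_gen`, divisors of a unit times a monomial are such, read cleanness off a best
  approximation (✓ `cleanRegAt_of_isMin_pthPowerApprox_zpow`).  The proof is the dim-3 proof token for token except the two dimension lines.
* `cleanLU_dim_of_isDefectlessField` — hence at every `O` with `(K, O)` a defectless field (✓ `exists_isMin_pthPowerApprox_of_isDefectlessField`).
* `cleanLU_dim_of_transcendenceDefect_eq_zero` — hence at every ABHYANKAR valuation of `K/k`, by Kuhlmann's generalized stability theorem
  (✓ `Kuhlmann2010Stability_holds`, dimension-free).

So, in every dimension, the defectless and Abhyankar halves of clean local uniformization cost exactly «embedded resolution of the remainder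
hypersurface `g₀ − f₀^p = 0`» and nothing else; the composition with `…CleanLUDimCases` is `…CleanModelsDimGEFourOfEmbRes.lean`.
-/

noncomputable section

set_option linter.dupNamespace false -- mandated namespace of this single-conjunct summit

open IsLocalRing AlgebraicGeometry CategoryTheory
open Literature.AlgebraicGeometry.Resolution

namespace Summit.ResolutionOfSingularities.ResolutionOfSingularities.Theorems.RadicialJung.CleanModels

variable {K : Type} [Field K]

/-! ## The defectless half in dimension `n + 1` -/

/-- **Clean local uniformization at an `(n+1)`-dimensional centre, for a valuation admitting a best `p`-th-power approximation of `g₀`, modulo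
embedded resolution of closed subsets of dimension `≤ N` (`n ≤ N`) of regular excellent schemes** (hypothesis `hEmb`: the CJS Cor. 1.5 shape
with bound `N`; printed for `N ≤ 2` only).  Setting: `k` of characteristic `p`, `K ⊇ k` a function field, `O` a valuation ring of `K`, `A ⊆ O` a
finitely generated affine model of `K` whose local ring at the centre of `O` is regular of dimension `n + 1`, `g₀ ∉ K^p`, `f₀^p` a best
`p`-th-power approximation of `g₀` for `v`.  Conclusion: that of the dim-`d` local input `hBest_d` of `…CleanLUDimCases` (= the registered stub
shape of `stub_cleanLU3` with `3 ↦ d`), verbatim.  The dim-3 theorem ✓ `cleanLU3_of_isMin_pthPowerApprox` is the case `n = N = 2`.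
[cite: CossartJannsenSaito2020, Cor. 1.5, p. 7] -/
theorem cleanLU_dim_of_isMin_pthPowerApprox (N : ℕ)
    (hEmb : ∀ (Z : Scheme.{0}) [IsIntegral Z] [IsNoetherian Z], Scheme.IsRegular Z →
      Scheme.IsExcellent Z → ∀ (X : Set Z), IsClosed X → X ≠ Set.univ → topologicalKrullDim X ≤ N →
        ∃ (Z' : Scheme.{0}) (π : Z' ⟶ Z), IsProper π ∧ Function.Surjective π.base ∧
          (∃ U : Z.Opens, (U : Set Z) = Xᶜ ∧ IsIso (π ∣_ U)) ∧
          IsStrictNormalCrossingsDivisor Z' (π.base ⁻¹' X))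
    (p : ℕ) (hp : p.Prime) (k : Type) [Field k] [CharP k p] (K : Type) [Field K] [Algebra k K]
    (O : ValuationSubring K) (A : Subalgebra k K) (hAO : A.toSubring ≤ O.toSubring) (hAfg : A.FG)
    (hfrac : IsFractionRing A K)
    (hreg : IsRegularLocalRing (locAtCentre A.toSubring O))
    {n : ℕ} (hn : n ≤ N) (hdim : ringKrullDim (locAtCentre A.toSubring O) = (n + 1 : ℕ))
    (g₀ : K) (hg₀ : ∀ c : K, c ^ p ≠ g₀)
    (f₀ : K) (hmin : ∀ f : K, O.valuation (g₀ - f₀ ^ p) ≤ O.valuation (g₀ - f ^ p)) :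
    ∃ (A' : Subalgebra k K), A'.toSubring ≤ O.toSubring ∧ A ≤ A' ∧ A'.FG ∧
      ∃ (_ : IsRegularLocalRing (locAtCentre A'.toSubring O)) (c : Fin p → K),
        (∃ j : Fin p, (j : ℕ) ≠ 0 ∧ c j ≠ 0) ∧
        ((∃ (d m : ℕ) (hmd : m ≤ d) (t : Fin d → ↥(locAtCentre A'.toSubring O)) (a : Fin m → ℕ)
            (u : ↥(locAtCentre A'.toSubring O)), IsUnit u ∧
            Ideal.span (Set.range t) = IsLocalRing.maximalIdeal ↥(locAtCentre A'.toSubring O) ∧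
            ringKrullDim ↥(locAtCentre A'.toSubring O) = (d : WithBot ℕ∞) ∧ 0 < m ∧ (∀ i, ¬ p ∣ a i) ∧
            (∑ j : Fin p, c j ^ p * g₀ ^ (j : ℕ)) =
              (u : K) * ∏ i : Fin m, ((t (Fin.castLE hmd i) : ↥(locAtCentre A'.toSubring O)) : K) ^ (a i)) ∨
          (∃ u : ↥(locAtCentre A'.toSubring O), IsUnit u ∧ (∑ j : Fin p, c j ^ p * g₀ ^ (j : ℕ)) = (u : K) ∧
            ∀ c' : ↥(locAtCentre A'.toSubring O), u - c' ^ p ∉ IsLocalRing.maximalIdeal ↥(locAtCentre A'.toSubring O)) ∨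
          (∃ s c' : ↥(locAtCentre A'.toSubring O), (∑ j : Fin p, c j ^ p * g₀ ^ (j : ℕ)) = (s : K) ∧
            s - c' ^ p ∈ IsLocalRing.maximalIdeal ↥(locAtCentre A'.toSubring O) ∧
            s - c' ^ p ∉ IsLocalRing.maximalIdeal ↥(locAtCentre A'.toSubring O) ^ 2)) := by
  classical
  haveI : Fact p.Prime := ⟨hp⟩
  haveI := hreg
  set S : Subring K := locAtCentre A.toSubring O with hSdef
  have hSO : S ≤ O.toSubring := locAtCentre_le hAO
  have hAS : A.toSubring ≤ S := le_locAtCentre A.toSubring O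
  haveI : CharP K p := charP_of_injective_algebraMap (algebraMap k K).injective p
  haveI : IsDomain S := inferInstance
  -- `S` is excellent: a localisation of the finitely generated `k`-algebra `A`
  haveI : Algebra.FiniteType k A := (Subalgebra.fg_iff_finiteType A).mp hAfg
  have hexcA : IsExcellentRing A := isExcellentRing_of_finiteType_field k A
  haveI := isLocalization_locAtCentre (K := K) (O := O) hAO
  have hexcS : IsExcellentRing S :=
    IsExcellentRing.of_isLocalization (A := A.toSubring) (B := S) (subringCentre A.toSubring O hAO).primeCompl hexcA
  -- the remainder `r = g₀ - f₀^p = x / y`, `x, y ∈ A`, and a nonzero `s ∈ 𝔪_S`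
  have hr0 : g₀ - f₀ ^ p ≠ 0 := fun h => hg₀ f₀ (sub_eq_zero.mp h).symm
  obtain ⟨x, y, hy, hxy⟩ := IsFractionRing.div_surjective (A := A) (g₀ - f₀ ^ p)
  have hy0 : (y : K) ≠ 0 := by
    intro h
    have : (y : A) = 0 := Subtype.ext h
    exact (nonZeroDivisors.ne_zero hy) this
  have hxy' : (x : K) / (y : K) = g₀ - f₀ ^ p := hxy
  have hx0 : (x : K) ≠ 0 := by
    intro h
    apply hr0
    rw [← hxy', h, zero_div]
  have hmne : maximalIdeal S ≠ ⊥ := by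
    intro hbot
    have hfield : IsField S := IsLocalRing.isField_iff_maximalIdeal_eq.mpr hbot
    have h0 : ringKrullDim S = 0 := ringKrullDim_eq_zero_of_isField hfield
    have h3 : ringKrullDim S = (n + 1 : ℕ) := hdim
    rw [h0] at h3
    have h3' : ((0 : ℕ) : WithBot ℕ∞) = ((n + 1 : ℕ) : WithBot ℕ∞) := by exact_mod_cast h3
    have h3'' : (0 : ℕ) = n + 1 := by exact_mod_cast h3'
    omega
  obtain ⟨s, hsm, hs0⟩ := Submodule.exists_mem_ne_zero_of_ne_bot hmne
  let xS : S := ⟨x, hAS x.2⟩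
  let yS : S := ⟨y, hAS y.2⟩
  let xR : S := xS * yS * s
  have hxR0 : xR ≠ 0 := by
    refine mul_ne_zero (mul_ne_zero ?_ ?_) hs0
    · exact fun h => hx0 (congrArg Subtype.val h)
    · exact fun h => hy0 (congrArg Subtype.val h)
  have hxRm : xR ∈ maximalIdeal S := Ideal.mul_mem_left _ _ hsm
  -- domination of `S` by `O`
  have hRO : ∀ r : S, algebraMap S K r ∈ O := fun r => hSO r.2
  have hRm : ∀ r : S, r ∈ maximalIdeal S ↔ O.valuation (algebraMap S K r) < 1 := fun r =>
    mem_maximalIdeal_locAtCentre_iff hAO r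
  -- MONOMIALIZE `x y s` along `v` (embedded resolution)
  obtain ⟨uu, -, huuO, R', _, _, _, hinj, hR'O, hR'm, hlow, hup, d, z, α, u, hu, hdimR', hspan, hfact⟩ :=
    exists_localRing_monomial_of_embeddedResolution_gen N hn hEmb (R := S) (K := K) (E := K) Subtype.val_injective hexcS
      hdim O hRO hRm xR hxR0 hxRm
  -- the subring `T = S[uu]` and the image `R₂ = locAtCentre T O` of `R'`
  let T : Subring K := (Algebra.adjoin S (uu : Set K)).toSubring
  have hTO : T ≤ O.toSubring := fun w hw => huuO w hw
  have hST : S ≤ T := fun w hw => (Algebra.adjoin S (uu : Set K)).algebraMap_mem (⟨w, hw⟩ : S)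
  have hTR : ∀ w ∈ T, w ∈ Set.range (algebraMap R' K) := fun w hw => hlow w hw
  set R₂ : Subring K := locAtCentre T O with hR₂def
  have hrange : (algebraMap R' K).range = R₂ := range_eq_locAtCentre (algebraMap R' K) O T hTR hR'm hup
  obtain ⟨hreg₂, z₂, u₂, hz₂, hu₂K, hspan₂, hdim₂, hu₂⟩ :=
    regular_data_of_range_eq (algebraMap R' K) hinj R₂ hrange z hspan hdimR' u hu
  haveI := hreg₂
  have hR₂O : R₂ ≤ O.toSubring := locAtCentre_le hTO
  have hdom₂ : ∀ w : R₂, w ∈ maximalIdeal R₂ → O.valuation (w : K) < 1 := fun w hw =>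
    (mem_maximalIdeal_locAtCentre_iff hTO w).mp hw
  have hTR₂ : T ≤ R₂ := le_locAtCentre T O
  -- `z₂` is a regular system of parameters of `R₂`
  have hd' : (maximalIdeal R₂).spanFinrank = d := by
    have h := IsRegularLocalRing.spanFinrank_maximalIdeal (R := R₂)
    rw [hdim₂] at h
    exact_mod_cast h
  have hzr : IsRsopPart z₂ := isRsopPart_comp_of_rsop hd' z₂ hspan₂ id Function.injective_id
  have hz0 : ∀ i, (z₂ i : K) ≠ 0 := fun i h => hzr.ne_zero i (Subtype.ext h)
  -- `x y s = u₂ ∏ z₂^α` in `R₂`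
  let x₂ : R₂ := ⟨x, hTR₂ (hST (hAS x.2))⟩
  let y₂ : R₂ := ⟨y, hTR₂ (hST (hAS y.2))⟩
  let s₂ : R₂ := ⟨s, hTR₂ (hST s.2)⟩
  have hfact₂ : x₂ * (y₂ * s₂) = u₂ * ∏ i, z₂ i ^ α i := by
    apply Subtype.ext
    have h1 : ((x₂ * (y₂ * s₂) : R₂) : K) = (x : K) * ((y : K) * (s : K)) := rfl
    have h2 : ((u₂ * ∏ i, z₂ i ^ α i : R₂) : K) = (u₂ : K) * ∏ i, (z₂ i : K) ^ α i := by
      push_cast; rfl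
    have h3 : algebraMap S K xR = (x : K) * (y : K) * (s : K) := rfl
    have h4 : algebraMap R' K (u * ∏ i, z i ^ α i) = (u₂ : K) * ∏ i, (z₂ i : K) ^ α i := by
      rw [map_mul, map_prod, ← hu₂K]
      simp_rw [map_pow, ← hz₂]
    rw [h1, h2, ← h4, ← hfact, h3, mul_assoc]
  -- divisors of a unit times a monomial in a regular system of parameters
  have hdvdx : x₂ ∣ ∏ i, z₂ i ^ α i :=
    (hu₂.dvd_mul_left).mp ⟨y₂ * s₂, hfact₂.symm⟩
  have hdvdy : y₂ ∣ ∏ i, z₂ i ^ α i :=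
    (hu₂.dvd_mul_left).mp ⟨x₂ * s₂, by rw [← hfact₂]; ring⟩
  obtain ⟨c₁, β, hxβ⟩ := CossartPiltantMonomial.exists_eq_units_mul_prod_pow_of_dvd (fun i => hzr.prime i) α hdvdx
  obtain ⟨c₂, γ, hyγ⟩ := CossartPiltantMonomial.exists_eq_units_mul_prod_pow_of_dvd (fun i => hzr.prime i) α hdvdy
  -- `g₀ - f₀^p = x / y` is a unit times a Laurent monomial
  let u' : R₂ := (c₁ * c₂⁻¹ : R₂ˣ)
  have hu' : IsUnit u' := Units.isUnit _
  let a : Fin d → ℤ := fun i => (β i : ℤ) - (γ i : ℤ)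
  have hxK : (x : K) = ((c₁ : R₂) : K) * ∏ i, (z₂ i : K) ^ β i := by
    have := congrArg (fun w : R₂ => (w : K)) hxβ
    simpa using this
  have hyK : (y : K) = ((c₂ : R₂) : K) * ∏ i, (z₂ i : K) ^ γ i := by
    have := congrArg (fun w : R₂ => (w : K)) hyγ
    simpa using this
  have hc₂0 : ((c₂ : R₂) : K) ≠ 0 := fun h => by
    have : ((c₂ : R₂) : K) * ((↑(c₂⁻¹ : R₂ˣ) : R₂) : K) = 1 := by
      rw [← Subring.coe_mul, ← Units.val_mul, mul_inv_cancel, Units.val_one, Subring.coe_one]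
    rw [h, zero_mul] at this
    exact zero_ne_one this
  have hu'K : (u' : K) = ((c₁ : R₂) : K) * (((c₂ : R₂) : K))⁻¹ := by
    have hinv : ((↑(c₂⁻¹ : R₂ˣ) : R₂) : K) = (((c₂ : R₂) : K))⁻¹ := by
      refine (eq_inv_of_mul_eq_one_right ?_)
      rw [← Subring.coe_mul, ← Units.val_mul, mul_inv_cancel, Units.val_one, Subring.coe_one]
    change (((c₁ * c₂⁻¹ : R₂ˣ) : R₂) : K) = _
    rw [Units.val_mul, Subring.coe_mul, hinv]
  have hG : g₀ - f₀ ^ p = (u' : K) * ∏ i, (z₂ i : K) ^ (a i) := by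
    have hprod : (∏ i, (z₂ i : K) ^ (a i)) = (∏ i, (z₂ i : K) ^ β i) / ∏ i, (z₂ i : K) ^ γ i := by
      rw [← Finset.prod_div_distrib]
      refine Finset.prod_congr rfl fun i _ => ?_
      rw [zpow_sub₀ (hz0 i), zpow_natCast, zpow_natCast]
    rw [← hxy', hxK, hyK, hu'K, hprod, mul_div_mul_comm, div_eq_mul_inv]
  -- READ OFF
  have hclean : CleanRegAt p R₂.subtype g₀ :=
    cleanRegAt_of_isMin_pthPowerApprox_zpow O R₂ hR₂O hdom₂ g₀ f₀ hmin z₂ hspan₂ hdim₂ hz0 a u' hu' hG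
  -- the finitely generated model `A' = A[uu]`
  let A' : Subalgebra k K :=
    { Subring.closure ((A.toSubring : Set K) ∪ ↑uu) with
      algebraMap_mem' := fun r => Subring.subset_closure (Or.inl (A.algebraMap_mem r)) }
  have hA'sub : A'.toSubring = Subring.closure ((A.toSubring : Set K) ∪ ↑uu) := rfl
  have hAA' : A ≤ A' := fun w hw => Subring.subset_closure (Or.inl hw)
  have huuO' : ∀ w ∈ (uu : Set K), w ∈ O := fun w hw => huuO w (Algebra.subset_adjoin hw)
  have hA'O : A'.toSubring ≤ O.toSubring := by
    rw [hA'sub, Subring.closure_le]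
    rintro w (hw | hw)
    · exact hAO hw
    · exact huuO' w hw
  have hA'fg : A'.FG := by
    obtain ⟨s₀, hs₀⟩ := hAfg
    refine ⟨s₀ ∪ uu, le_antisymm ?_ ?_⟩
    · rw [Algebra.adjoin_le_iff]
      rintro w hw
      rw [Finset.coe_union] at hw
      rcases hw with hw | hw
      · exact hAA' (hs₀ ▸ Algebra.subset_adjoin hw)
      · exact Subring.subset_closure (Or.inr hw)
    · intro w hw
      change w ∈ Subring.closure ((A.toSubring : Set K) ∪ ↑uu) at hw
      have hle : Subring.closure ((A.toSubring : Set K) ∪ ↑uu) ≤ (Algebra.adjoin k (↑(s₀ ∪ uu) : Set K)).toSubring := by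
        rw [Subring.closure_le]
        rintro v (hv | hv)
        · have : v ∈ Algebra.adjoin k (s₀ : Set K) := by rw [hs₀]; exact hv
          exact Algebra.adjoin_mono (by rw [Finset.coe_union]; exact Set.subset_union_left) this
        · exact Algebra.subset_adjoin (by rw [Finset.coe_union]; exact Or.inr hv)
      exact hle hw
  -- `R₂ = locAtCentre A' O`
  have hT : T = Subring.closure ((S : Set K) ∪ ↑uu) := by
    change (Algebra.adjoin S (uu : Set K)).toSubring = _
    rw [Algebra.adjoin_eq_ring_closure]
    congr 1
    ext w
    simp only [Set.mem_union, Set.mem_range, SetLike.mem_coe]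
    constructor
    · rintro (⟨r, rfl⟩ | h)
      · exact Or.inl r.2
      · exact Or.inr h
    · rintro (h | h)
      · exact Or.inl ⟨⟨w, h⟩, rfl⟩
      · exact Or.inr h
  have hR₂A' : R₂ = locAtCentre A'.toSubring O := by
    rw [hR₂def, hT, hSdef, PfaffLine.locAtCentre_closure_locAtCentre_union, hA'sub]
  -- assemble
  refine ⟨A', hA'O, hAA', hA'fg, ?_⟩
  rw [← hR₂A']
  obtain ⟨hregR, c, hc, hform⟩ := hclean
  exact ⟨hregR, c, hc, forms_of_looseCleanForm hform⟩

/-! ## Defectless fields and Abhyankar valuations, dimension `n + 1` -/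

/-- **Clean local uniformization at an `(n+1)`-dimensional centre at every valuation ring `O` for which `(K, O)` is a defectless field**,
modulo embedded resolution of closed subsets of dimension `≤ N` (`n ≤ N`): a defectless purely inseparable extension of height one admits best
approximations (✓ `exists_isMin_pthPowerApprox_of_isDefectlessField`), then `cleanLU_dim_of_isMin_pthPowerApprox`.  The dim-3 theorem
✓ `cleanLU3_of_isDefectlessField` is the case `n = N = 2`. [cite: CossartJannsenSaito2020, Cor. 1.5, p. 7] -/
theorem cleanLU_dim_of_isDefectlessField (N : ℕ)
    (hEmb : ∀ (Z : Scheme.{0}) [IsIntegral Z] [IsNoetherian Z], Scheme.IsRegular Z →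
      Scheme.IsExcellent Z → ∀ (X : Set Z), IsClosed X → X ≠ Set.univ → topologicalKrullDim X ≤ N →
        ∃ (Z' : Scheme.{0}) (π : Z' ⟶ Z), IsProper π ∧ Function.Surjective π.base ∧
          (∃ U : Z.Opens, (U : Set Z) = Xᶜ ∧ IsIso (π ∣_ U)) ∧
          IsStrictNormalCrossingsDivisor Z' (π.base ⁻¹' X))
    (p : ℕ) (hp : p.Prime) (k : Type) [Field k] [CharP k p] (K : Type) [Field K] [Algebra k K]
    (O : ValuationSubring K) (A : Subalgebra k K) (hAO : A.toSubring ≤ O.toSubring) (hAfg : A.FG)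
    (hfrac : IsFractionRing A K)
    (hreg : IsRegularLocalRing (locAtCentre A.toSubring O))
    {n : ℕ} (hn : n ≤ N) (hdim : ringKrullDim (locAtCentre A.toSubring O) = (n + 1 : ℕ))
    (g₀ : K) (hg₀ : ∀ c : K, c ^ p ≠ g₀) (hdef : IsDefectlessField K O) :
    ∃ (A' : Subalgebra k K), A'.toSubring ≤ O.toSubring ∧ A ≤ A' ∧ A'.FG ∧
      ∃ (_ : IsRegularLocalRing (locAtCentre A'.toSubring O)) (c : Fin p → K),
        (∃ j : Fin p, (j : ℕ) ≠ 0 ∧ c j ≠ 0) ∧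
        ((∃ (d m : ℕ) (hmd : m ≤ d) (t : Fin d → ↥(locAtCentre A'.toSubring O)) (a : Fin m → ℕ)
            (u : ↥(locAtCentre A'.toSubring O)), IsUnit u ∧
            Ideal.span (Set.range t) = IsLocalRing.maximalIdeal ↥(locAtCentre A'.toSubring O) ∧
            ringKrullDim ↥(locAtCentre A'.toSubring O) = (d : WithBot ℕ∞) ∧ 0 < m ∧ (∀ i, ¬ p ∣ a i) ∧
            (∑ j : Fin p, c j ^ p * g₀ ^ (j : ℕ)) =
              (u : K) * ∏ i : Fin m, ((t (Fin.castLE hmd i) : ↥(locAtCentre A'.toSubring O)) : K) ^ (a i)) ∨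
          (∃ u : ↥(locAtCentre A'.toSubring O), IsUnit u ∧ (∑ j : Fin p, c j ^ p * g₀ ^ (j : ℕ)) = (u : K) ∧
            ∀ c' : ↥(locAtCentre A'.toSubring O), u - c' ^ p ∉ IsLocalRing.maximalIdeal ↥(locAtCentre A'.toSubring O)) ∨
          (∃ s c' : ↥(locAtCentre A'.toSubring O), (∑ j : Fin p, c j ^ p * g₀ ^ (j : ℕ)) = (s : K) ∧
            s - c' ^ p ∈ IsLocalRing.maximalIdeal ↥(locAtCentre A'.toSubring O) ∧
            s - c' ^ p ∉ IsLocalRing.maximalIdeal ↥(locAtCentre A'.toSubring O) ^ 2)) := by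
  haveI : Fact p.Prime := ⟨hp⟩
  haveI : CharP K p := charP_of_injective_algebraMap (algebraMap k K).injective p
  obtain ⟨f₀, hf₀⟩ := exists_isMin_pthPowerApprox_of_isDefectlessField O hdef g₀ hg₀
  exact cleanLU_dim_of_isMin_pthPowerApprox N hEmb p hp k K O A hAO hAfg hfrac hreg hn hdim g₀ hg₀ f₀ hf₀

/-- **Clean local uniformization at an `(n+1)`-dimensional centre at every valuation WITHOUT TRANSCENDENCE DEFECT** (Abhyankar valuations of
`K/k`), modulo embedded resolution of closed subsets of dimension `≤ N` (`n ≤ N`): by Kuhlmann's generalized stability theorem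
(✓ `Kuhlmann2010Stability_holds`) `(K, O)` is a defectless field.  This is the dim-`d` local input `hAbh_d` of `…CleanLUDimCases`
(`d = n + 1`) modulo `hEmb_N`; the dim-3 theorem ✓ `cleanLU3_of_transcendenceDefect_eq_zero` is the case `n = N = 2`.
[cite: Kuhlmann2010, Thm. 1.1] [cite: CossartJannsenSaito2020, Cor. 1.5, p. 7] -/
theorem cleanLU_dim_of_transcendenceDefect_eq_zero (N : ℕ)
    (hEmb : ∀ (Z : Scheme.{0}) [IsIntegral Z] [IsNoetherian Z], Scheme.IsRegular Z →
      Scheme.IsExcellent Z → ∀ (X : Set Z), IsClosed X → X ≠ Set.univ → topologicalKrullDim X ≤ N →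
        ∃ (Z' : Scheme.{0}) (π : Z' ⟶ Z), IsProper π ∧ Function.Surjective π.base ∧
          (∃ U : Z.Opens, (U : Set Z) = Xᶜ ∧ IsIso (π ∣_ U)) ∧
          IsStrictNormalCrossingsDivisor Z' (π.base ⁻¹' X))
    (p : ℕ) (hp : p.Prime) (k : Type) [Field k] [CharP k p] (K : Type) [Field K] [Algebra k K]
    (O : ValuationSubring K) (A : Subalgebra k K) (hAO : A.toSubring ≤ O.toSubring) (hAfg : A.FG)
    (hfrac : IsFractionRing A K)
    (hreg : IsRegularLocalRing (locAtCentre A.toSubring O))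
    {n : ℕ} (hn : n ≤ N) (hdim : ringKrullDim (locAtCentre A.toSubring O) = (n + 1 : ℕ))
    (g₀ : K) (hg₀ : ∀ c : K, c ^ p ≠ g₀)
    (hk : ∀ c : k, algebraMap k K c ∈ O) (htd : transcendenceDefect k O hk = 0) :
    ∃ (A' : Subalgebra k K), A'.toSubring ≤ O.toSubring ∧ A ≤ A' ∧ A'.FG ∧
      ∃ (_ : IsRegularLocalRing (locAtCentre A'.toSubring O)) (c : Fin p → K),
        (∃ j : Fin p, (j : ℕ) ≠ 0 ∧ c j ≠ 0) ∧
        ((∃ (d m : ℕ) (hmd : m ≤ d) (t : Fin d → ↥(locAtCentre A'.toSubring O)) (a : Fin m → ℕ)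
            (u : ↥(locAtCentre A'.toSubring O)), IsUnit u ∧
            Ideal.span (Set.range t) = IsLocalRing.maximalIdeal ↥(locAtCentre A'.toSubring O) ∧
            ringKrullDim ↥(locAtCentre A'.toSubring O) = (d : WithBot ℕ∞) ∧ 0 < m ∧ (∀ i, ¬ p ∣ a i) ∧
            (∑ j : Fin p, c j ^ p * g₀ ^ (j : ℕ)) =
              (u : K) * ∏ i : Fin m, ((t (Fin.castLE hmd i) : ↥(locAtCentre A'.toSubring O)) : K) ^ (a i)) ∨
          (∃ u : ↥(locAtCentre A'.toSubring O), IsUnit u ∧ (∑ j : Fin p, c j ^ p * g₀ ^ (j : ℕ)) = (u : K) ∧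
            ∀ c' : ↥(locAtCentre A'.toSubring O), u - c' ^ p ∉ IsLocalRing.maximalIdeal ↥(locAtCentre A'.toSubring O)) ∨
          (∃ s c' : ↥(locAtCentre A'.toSubring O), (∑ j : Fin p, c j ^ p * g₀ ^ (j : ℕ)) = (s : K) ∧
            s - c' ^ p ∈ IsLocalRing.maximalIdeal ↥(locAtCentre A'.toSubring O) ∧
            s - c' ^ p ∉ IsLocalRing.maximalIdeal ↥(locAtCentre A'.toSubring O) ^ 2)) :=
  cleanLU_dim_of_isDefectlessField N hEmb p hp k K O A hAO hAfg hfrac hreg hn hdim g₀ hg₀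
    (Kuhlmann2010Stability_holds k K (intermediateField_top_fg A hAfg hfrac) O hk htd)

end Summit.ResolutionOfSingularities.ResolutionOfSingularities.Theorems.RadicialJung.CleanModels

end
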